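import Literature.Barriers.ResolutionOfSingularities.LocalMonomializationFailsValuation
import Literature.AlgebraicGeometry.Resolution.QuadraticTransformsTransport
import Mathlib.RingTheory.AlgebraicIndependent.Transcendental
import HarnessLib

/-!
# Cutkosky's counterexample: the classification of the `A'` (the `K`-side)

`Literature/Barriers/ResolutionOfSingularities/LocalMonomializationFailsClassA.lean` — "the
bottom row of (12) is the complete list of all two dimensional regular algebraic local rings of
`K` dominating `A` and dominated by `V`" (Cutkosky §3, p. 7; `V = V* ∩ K`), GRANTED Theorem 2.1
(`AbhyankarQuadraticFactorization`), Lemma 2.2 (`AbhyankarQuadraticUnion`) and Lemma 3.1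
(`CutkoskyLemma31`, for the tower): every regular algebraic local ring `A'` of `K = F(u,v)`
(over `F`) dominated by `V*` and dominating `A = A₀` is some `A_m` (`eq_Aring_of_dominated`).
The rings `A_m` live in `L = K*` but are local rings OF the subfield `K`; the classification is
obtained by pulling back along `K ↪ L` (`QuadraticTransformsTransport.lean`) — in particular
`dim A' = 2` is computed in `K` (`LocalMonomializationFailsAlgebraic.lean`, residues of
`V* ∩ K` are scalars). PROVED. [cite: Cutkosky2014, §3 (p. 7)]
-/

noncomputable section

namespace Literature.Barriers.ResolutionOfSingularities

namespace Cutkosky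

open Literature.AlgebraicGeometry.Resolution IsLocalRing
open scoped IntermediateField

universe u

variable {F : Type u} [Field F] {L : Type u} [Field L] [Algebra F L]

/-! ## Generalities: local rings on coordinates in an intermediate field; valuations pulled back -/

section General

/-- If the coordinates lie in an intermediate field `K` then so does `F[z]_{(z)}`. [folklore] -/
theorem originLocalRing_le_intermediateField {n : ℕ} {z : Fin n → L} (hz : AlgebraicIndependent F z)
    (K : IntermediateField F L) (hK : ∀ i, z i ∈ K) : (originLocalRing hz).toSubring ≤ K.toSubring := by
  intro q hq
  obtain ⟨f, g, -, rfl⟩ := (mem_originLocalRing_iff hz).mp hq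
  have hmem : ∀ h : MvPolynomial (Fin n) F, MvPolynomial.aeval z h ∈ K := by
    intro h
    induction h using MvPolynomial.induction_on with
    | C a => rw [MvPolynomial.aeval_C]; exact K.algebraMap_mem a
    | add f g hf hg => rw [map_add]; exact add_mem hf hg
    | mul_X f i hf => rw [map_mul, MvPolynomial.aeval_X]; exact mul_mem hf (hK i)
  change MvPolynomial.aeval z f / MvPolynomial.aeval z g ∈ K
  exact div_mem (hmem f) (hmem g)

/-- The coordinates of a quadratic transform of a point with coordinates in `K` lie in `K`.
[cite: Cutkosky2014, §3] -/
theorem bCoord_mem (p : ℕ) (K : IntermediateField F L) {P Q : L} (hP : P ∈ K) (hQ : Q ∈ K) (γ : F)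
    (i : ℕ) : ∀ k, bCoord F L p P Q γ i k ∈ K := by
  refine Fin.forall_fin_two.mpr ?_
  unfold bCoord
  split_ifs
  · exact ⟨div_mem hP (pow_mem hQ _), hQ⟩
  · exact ⟨hQ, sub_mem (div_mem hP (pow_mem hQ _)) (K.algebraMap_mem γ)⟩

/-- The range of `K ↪ L` is `K`. [folklore] -/
theorem range_val_toRingHom (K : IntermediateField F L) : (K.val.toRingHom).range = K.toSubring := by
  ext z
  constructor
  · rintro ⟨w, rfl⟩; exact w.2
  · intro hz; exact ⟨⟨z, hz⟩, rfl⟩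

/-- For `a ∈ O`, `a ≠ 0`: `ν(a) > 0` iff `a⁻¹ ∉ O`. [folklore] -/
theorem valuation_lt_one_iff_inv_not_mem {E : Type u} [Field E] (O : ValuationSubring E) {a : E}
    (ha : a ∈ O) (h0 : a ≠ 0) : O.valuation a < 1 ↔ a⁻¹ ∉ O := by
  constructor
  · intro hlt hinv
    have h1 : O.valuation a⁻¹ ≤ 1 := (O.valuation_le_one_iff _).mpr hinv
    rw [map_inv₀, inv_le_one₀ (pos_iff_ne_zero.mpr ((map_ne_zero _).mpr h0))] at h1
    exact not_lt.mpr h1 hlt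
  · intro hinv
    rcases ((O.valuation_le_one_iff _).mpr ha).lt_or_eq with hlt | heq
    · exact hlt
    · exfalso; apply hinv
      rw [← O.valuation_le_one_iff, map_inv₀, heq, inv_one]

/-- **Scalar residues pull back** along a field embedding `ι : K₀ → L`: if every element of `O`
is a scalar modulo `𝔪_O` then so is every element of `O.comap ι`. [folklore] -/
theorem residue_comap {K₀ : Type u} [Field K₀] [Algebra F K₀] (ι : K₀ →ₐ[F] L) (O : ValuationSubring L)
    (hres : ∀ z ∈ O, ∃ c : F, O.valuation (z - algebraMap F L c) < 1) :
    ∀ z ∈ O.comap ι.toRingHom, ∃ c : F, (O.comap ι.toRingHom).valuation (z - algebraMap F K₀ c) < 1 := by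
  intro z hz
  rw [ValuationSubring.mem_comap] at hz
  obtain ⟨c, hc⟩ := hres _ hz
  refine ⟨c, ?_⟩
  have hιz : ι.toRingHom (z - algebraMap F K₀ c) = ι z - algebraMap F L c := by
    rw [map_sub]; exact congrArg _ (ι.commutes c)
  by_cases h0 : z - algebraMap F K₀ c = 0
  · rw [h0, map_zero]; exact zero_lt_one
  have hmem : z - algebraMap F K₀ c ∈ O.comap ι.toRingHom := by
    rw [ValuationSubring.mem_comap, hιz, ← O.valuation_le_one_iff]; exact hc.le
  have h0' : ι.toRingHom (z - algebraMap F K₀ c) ≠ 0 := by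
    rw [map_ne_zero_iff _ ι.toRingHom.injective]; exact h0
  rw [valuation_lt_one_iff_inv_not_mem _ hmem h0, ValuationSubring.mem_comap, map_inv₀]
  rw [← valuation_lt_one_iff_inv_not_mem O (by rwa [ValuationSubring.mem_comap] at hmem) h0', hιz]
  exact hc

/-! ## Pulling back an algebraic local ring of `K` to the field `K` -/

/-- An algebraic local ring of the subfield `K ⊆ L` pulls back to an algebraic local ring OF the
field `K`. [folklore] -/
theorem isAlgebraicLocalRingOf_comap (K : IntermediateField F L) {A' : Subalgebra F L}
    (hA' : IsAlgebraicLocalRingOf F L K A') : IsAlgebraicLocalRingOf F K ⊤ (A'.comap K.val) := by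
  obtain ⟨hloc, hsub, hfracK, R, hRfg, hRA, hfrac⟩ := hA'
  haveI := hloc
  have hAr : A'.toSubring ≤ (K.val.toRingHom).range := by
    rw [range_val_toRingHom]; exact fun z hz => hsub hz
  have hlocal : IsLocalRing (A'.comap K.val) := isLocalRing_comap (ι := K.val.toRingHom) hAr
  refine ⟨hlocal, fun _ _ => IntermediateField.mem_top, ?_, R.comap K.val, ?_, fun _ hz => hRA hz, ?_⟩
  · intro w _
    obtain ⟨a, ha, b, hb, hb0, hw⟩ := hfracK (w : L) w.2
    refine ⟨⟨a, hsub ha⟩, ha, ⟨b, hsub hb⟩, hb, fun h => hb0 (congrArg Subtype.val h), Subtype.ext ?_⟩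
    exact hw
  · have hmap : (R.comap K.val).map K.val = R := by
      ext r
      rw [Subalgebra.mem_map]
      constructor
      · rintro ⟨w, hw, rfl⟩; exact hw
      · intro hr; exact ⟨⟨r, hsub (hRA hr)⟩, hr, rfl⟩
    refine Subalgebra.fg_of_fg_map _ K.val (fun _ _ h => Subtype.ext h) ?_
    rw [hmap]; exact hRfg
  · intro w hw
    obtain ⟨r, hr, s, hs, hs0, hsinv, hwrs⟩ := hfrac (w : L) hw
    have hrK : r ∈ K := hsub (hRA hr)
    have hsK : s ∈ K := hsub (hRA hs)
    refine ⟨⟨r, hrK⟩, hr, ⟨s, hsK⟩, hs, fun h => hs0 (congrArg Subtype.val h), ?_, Subtype.ext hwrs⟩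
    change ((⟨s, hsK⟩ : K) : L)⁻¹ ∈ A'
    exact hsinv


end General

/-! ## The `A`-tower lies in `K` and is dominated by `V*` -/

section ClassA

variable (p : ℕ) [hp : Fact p.Prime] [CharP F p] {x y : L} (hxy : AlgebraicIndependent F ![x, y])
  (hgen : IntermediateField.adjoin F {x, y} = ⊤)
  (h3 : ∃ a b c : F, a ≠ b ∧ b ≠ c ∧ a ≠ c) (hL : CutkoskyLemma31.{u})

/-- `A_m` is a regular local ring. [cite: Cutkosky2014, §3] -/
theorem isRegularLocalRing_Aring (m : ℕ) : IsRegularLocalRing (Aring p hxy hgen h3 hL m).toSubring :=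
  isRegularLocalRing_originLocalRing (algebraicIndependent_Afam p hxy hgen h3 hL m)

/-- `dim A_m = 2`. [cite: Cutkosky2014, §3] -/
theorem ringKrullDim_Aring (m : ℕ) : ringKrullDim (Aring p hxy hgen h3 hL m).toSubring = 2 := by
  have := ringKrullDim_originLocalRing (algebraicIndependent_Afam p hxy hgen h3 hL m)
  exact this

/-- The stage coordinates `a = (u_{pi}, v_{pi})` lie in `K`. [cite: Cutkosky2014, §3] -/
theorem stage_a_mem_Kuv (i : ℕ) (k : Fin 2) : (stage p hxy hgen h3 hL i).a k ∈ Kuv F p x y := by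
  have hk : (stage p hxy hgen h3 hL i).a k ∈ IntermediateField.adjoin F (Set.range (stage p hxy hgen h3 hL i).a) :=
    IntermediateField.subset_adjoin _ _ ⟨k, rfl⟩
  rwa [(stage p hxy hgen h3 hL i).hgenA] at hk

/-- The coordinates of `A_m` lie in `K`. [cite: Cutkosky2014, §3] -/
theorem Afam_mem_Kuv (m : ℕ) (k : Fin 2) : Afam p hxy hgen h3 hL m k ∈ Kuv F p x y :=
  bCoord_mem p (Kuv F p x y) (stage_a_mem_Kuv p hxy hgen h3 hL _ 0) (stage_a_mem_Kuv p hxy hgen h3 hL _ 1) _ _ k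

/-- **`A_m ⊆ K`.** [cite: Cutkosky2014, §3] -/
theorem Aring_le_Kuv (m : ℕ) : (Aring p hxy hgen h3 hL m).toSubring ≤ (Kuv F p x y).toSubring :=
  originLocalRing_le_intermediateField _ _ (Afam_mem_Kuv p hxy hgen h3 hL m)

/-- `A_m ⊆ A_{m+1}`. [cite: Cutkosky2014, §3 (12)] -/
theorem Aring_le_succ (m : ℕ) : Aring p hxy hgen h3 hL m ≤ Aring p hxy hgen h3 hL (m + 1) :=
  (Aring_succ p hxy hgen h3 hL m).2.1

/-- The `A`-tower is increasing. [cite: Cutkosky2014, §3 (12)] -/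
theorem Aring_mono : Monotone (Aring p hxy hgen h3 hL) :=
  monotone_nat_of_le_succ (Aring_le_succ p hxy hgen h3 hL)

/-- Later members of the `A`-tower dominate earlier ones. [cite: Cutkosky2014, §3 (12)] -/
theorem Aring_dominates_of_le {m m' : ℕ} (h : m ≤ m') :
    SubringDominates (Aring p hxy hgen h3 hL m).toSubring (Aring p hxy hgen h3 hL m').toSubring := by
  induction h with
  | refl => exact SubringDominates.refl _
  | step _ ih => exact ih.trans (Aring_succ p hxy hgen h3 hL _).2

/-- **`V*` dominates every `A_m`** (through `A_m ⊆ A_{pm} ⊆ B_{pm} ⊆ V*`). [cite: Cutkosky2014, §3 (p. 7)] -/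
theorem dominates_Aring_Vstar (m : ℕ) :
    SubringDominates (Aring p hxy hgen h3 hL m).toSubring (Vstar p hxy hgen h3 hL).toSubring :=
  ((Aring_dominates_of_le p hxy hgen h3 hL (Nat.le_mul_of_pos_left m hp.out.pos)).trans
    ((dominates_iff_subringDominates _ _).mp (dominates_Aring_Bring p hxy hgen h3 hL m))).trans
    (dominates_Bring_Vstar p hxy hgen h3 hL (p * m))

/-- Every element of `K` is a fraction of elements of `A₀ = A`. [cite: Cutkosky2014, §3] -/
theorem Kuv_frac (z : Kuv F p x y) :
    ∃ a ∈ (Aring p hxy hgen h3 hL 0).toSubring, ∃ b ∈ (Aring p hxy hgen h3 hL 0).toSubring,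
      b ≠ 0 ∧ (Kuv F p x y).val.toRingHom z = a / b := by
  rw [Aring_zero]
  have hz : (z : L) ∈ IntermediateField.adjoin F (Set.range ![cu p x y, cv p x y]) := by
    rw [range_pair]; exact z.2
  obtain ⟨r, s, hrs⟩ := (IntermediateField.mem_adjoin_range_iff F _ _).mp hz
  set huv := algebraicIndependent_uv F p hgen hxy
  by_cases hs : MvPolynomial.aeval ![cu p x y, cv p x y] s = 0
  · refine ⟨0, Subalgebra.zero_mem _, 1, Subalgebra.one_mem _, one_ne_zero, ?_⟩
    change (z : L) = 0 / 1
    rw [hrs, hs, div_zero, zero_div]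
  · exact ⟨_, aeval_mem_originLocalRing huv r, _, aeval_mem_originLocalRing huv s, hs, hrs⟩

include hxy hgen in
/-- `trdeg_F K = 2` (`L` is algebraic over `K` and `trdeg_F L = 2`). [cite: Cutkosky2014, §3] -/
theorem trdeg_Kuv : Algebra.trdeg F (Kuv F p x y) = 2 := by
  haveI := isAlgebraic_Kuv F p hgen (x := x) (y := y)
  have h := trdeg_add_eq F (Kuv F p x y) (A := L)
  rw [trdeg_eq_zero (R := Kuv F p x y) (A := L), add_zero, trdeg_L hxy hgen] at h
  exact h


/-- **The classification of the `A'`** ("the bottom row of (12) is the complete list of all two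
dimensional regular algebraic local rings of `K` dominating `A` and dominated by `V`", granted
Theorem 2.1, Lemma 2.2 and Lemma 3.1): every regular algebraic local ring `A'` of `K = F(u,v)`
(over `F`) dominated by `V*` and dominating `A = A₀` is one of the `A_m`. [cite: Cutkosky2014, §3 (p. 7)] -/
theorem eq_Aring_of_dominated (hF : AbhyankarQuadraticFactorization.{u}) (hU : AbhyankarQuadraticUnion.{u})
    {A' : Subalgebra F L} (hA' : IsAlgebraicLocalRingOf F L (Kuv F p x y) A') (hreg : IsRegularLocalRing A')
    (hdomV : ValuationDominates F L (Vstar p hxy hgen h3 hL) A')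
    (hdom0 : Dominates F L (Aring p hxy hgen h3 hL 0) A') :
    ∃ m, A' = Aring p hxy hgen h3 hL m := by
  set K := Kuv F p x y
  set ι : K →+* L := K.val.toRingHom
  have hrangeK : ι.range = K.toSubring := range_val_toRingHom K
  have hsub : A'.toSubring ≤ K.toSubring := fun z hz => hA'.2.1 hz
  have hAr : A'.toSubring ≤ ι.range := by rw [hrangeK]; exact hsub
  -- `dim A' = 2`, computed in the field `K`
  have hA'' := isAlgebraicLocalRingOf_comap K hA'
  have hAO : (A'.comap K.val).toSubring ≤ ((Vstar p hxy hgen h3 hL).comap ι).toSubring := by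
    intro z hz
    exact hdomV.1 hz
  have hres := residue_comap K.val (Vstar p hxy hgen h3 hL) (Vstar_residue p hxy hgen h3 hL hU)
  have hdim'' : ringKrullDim (A'.comap K.val) = 2 :=
    ringKrullDim_eq_of_isAlgebraicLocalRingOf hA'' hAO hres (trdeg_Kuv p hxy hgen)
  have hdim : ringKrullDim A'.toSubring = 2 := by
    rw [← ringKrullDim_comap (ι := ι) hAr]
    exact hdim''
  -- classification inside `K`
  obtain ⟨n, hn⟩ := AbhyankarQuadraticFactorization.exists_eq_of_dominated_of_le_range (ι := ι) hF
    (O := Vstar p hxy hgen h3 hL) (R := fun m => (Aring p hxy hgen h3 hL m).toSubring)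
    (isRegularLocalRing_Aring p hxy hgen h3 hL) (ringKrullDim_Aring p hxy hgen h3 hL 0)
    (fun m => by rw [hrangeK]; exact Aring_le_Kuv p hxy hgen h3 hL m) (Kuv_frac p hxy hgen h3 hL)
    (fun m => ⟨(Aring_succ p hxy hgen h3 hL m).1, dominates_Aring_Vstar p hxy hgen h3 hL (m + 1)⟩)
    (S := A'.toSubring) hreg hdim hAr hdom0 hdomV
  exact ⟨n, Subalgebra.toSubring_injective hn⟩

end ClassA

end Cutkosky

end Literature.Barriers.ResolutionOfSingularities

end
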